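import Literature.NumberTheory.Automorphic.UnipotentSolvable
import HarnessLib

/-!
# Layers of the flag filtration: monotonicity and powers (Springer 2.4.13, for 6.3.5)

Trunk T-AUTOMORPHIC (G25 AutomorphicL); a small companion of `UnipotentSolvable.lean`
(namespace `Literature.Automorphic`; `flagFiltration F m = Φ_m ≤ GL n k`: the `g` stabilising every
`F_j` with `(g - 1) F_j ⊆ F_{j-m}`, truncated subtraction; `glLin g = toLin' g`;
`commutator_flagFiltration_le`: `(Φ_a, Φ_b) ≤ Φ_{a+b}`, so the layers `Φ_a / Φ_{a+1}`, `a ≥ 1`,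
are abelian). All proved:

* `flagFiltration_antitone` — `Φ_{m'} ≤ Φ_m` for `m ≤ m'` when `F` is monotone;
* `le_flagFiltration_one`, `exists_flag_le_flagFiltration_one` — a group `U` of unipotent
  matrices lies in `Φ₁` of a complete flag (the matrix form of Kolchin's theorem 2.4.12, from
  `exists_flag_forall_sub_mem` of `BurnsideKolchin.lean`; `UnipotentSolvable.lean` inlines this
  inside `IsUnipotentSubgroup.isNilpotent`);
* **powers in the layers**: `pow_glLin_sub_sub_mem` (`gᴹ v - v ≡ M (g v - v)` two layers
  down, for `g ∈ Φ_a`), whence `pow_mem_flagFiltration_succ_iff` (**the layers have no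
  `M`-torsion for `M` invertible in `k`**: `gᴹ ∈ Φ_{a+1} ↔ g ∈ Φ_{a+1}` for `g ∈ Φ_a`,
  `a ≥ 1`) and `pow_char_mem_flagFiltration_succ` (**in characteristic `p` the layers are
  `p`-torsion**: `g ∈ Φ_a ⇒ gᵖ ∈ Φ_{a+1}`).

The last two give the divisibility structure of unipotent groups used by the finite-group proof
of the conjugacy theorems of Springer 6.3.5 (`SolvableGroupTori.lean`, with
`SchurZassenhausDivisible.lean`).

## References

* [SpringerLAG1998] T. A. Springer, *Linear Algebraic Groups*, 2nd ed., Progress in Mathematics 9,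
  Birkhäuser (1998), 2.4.12–2.4.13, 6.3.5.
-/

open scoped MatrixGroups

namespace Literature.NumberTheory.Automorphic

open scoped Matrix

variable {k : Type*} [Field k] {n : Type*} [Fintype n] [DecidableEq n]
  {F : ℕ → Submodule k (n → k)}

/-! ### Monotonicity; unipotent groups lie in `Φ₁` -/

/-- The flag filtration decreases in `m` (for `F` monotone). [folklore] -/
theorem flagFiltration_antitone (hF : Monotone F) {m m' : ℕ} (h : m ≤ m') :
    flagFiltration F m' ≤ flagFiltration F m := by
  intro g hg
  rw [mem_flagFiltration_iff] at hg ⊢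
  intro j
  exact ⟨(hg j).1, fun v hv => hF (Nat.sub_le_sub_left h j) ((hg j).2 v hv)⟩

/-- A group `U` with `(u - 1) F_{i+1} ⊆ F_i` for all `u ∈ U` lies in `Φ₁` (for `F` monotone with
`F₀ = 0`). [folklore] -/
theorem le_flagFiltration_one {U : Subgroup (GL n k)} (hF0 : F 0 = ⊥) (hmono : Monotone F)
    (hU : ∀ i, ∀ u ∈ U, ∀ v ∈ F (i + 1), glLin u v - v ∈ F i) : U ≤ flagFiltration F 1 := by
  intro u hu
  rw [mem_flagFiltration_iff]
  have key : ∀ j, ∀ v ∈ F j, glLin u v - v ∈ F (j - 1) ∧ glLin u v ∈ F j := by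
    intro j v hv
    rcases Nat.eq_zero_or_pos j with rfl | hj
    · rw [hF0, Submodule.mem_bot] at hv
      subst hv
      simp [hF0]
    · obtain ⟨i, rfl⟩ := Nat.exists_eq_add_of_le' hj
      have h := hU i u hu v hv
      refine ⟨by simpa using h, ?_⟩
      have e : glLin u v = (glLin u v - v) + v := by abel
      rw [e]
      exact Submodule.add_mem _ (hmono (Nat.le_succ i) (by simpa using h)) hv
  exact fun j => ⟨fun v hv => (key j v hv).2, fun v hv => (key j v hv).1⟩

/-- **Kolchin's theorem, matrix flag form** (Springer 2.4.12: *"there is `x ∈ GL_n` with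
`x U x⁻¹ ⊆ 𝐔ₙ`"*): a subgroup `U ≤ GL n k` of unipotent matrices over an algebraically closed
field lies in `Φ₁` of a complete flag `0 = F₀ ⊆ ⋯ ⊆ F_n = kⁿ` (from `exists_flag_forall_sub_mem` of
`BurnsideKolchin.lean`). [cite: SpringerLAG1998, 2.4.12] -/
theorem exists_flag_le_flagFiltration_one [IsAlgClosed k] {U : Subgroup (GL n k)}
    (hU : IsUnipotentSubgroup U) :
    ∃ F : ℕ → Submodule k (n → k), F 0 = ⊥ ∧ Monotone F ∧ F (Fintype.card n) = ⊤ ∧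
      U ≤ flagFiltration F 1 := by
  set S : Submonoid (Module.End k (n → k)) :=
    (U.toSubmonoid.map (Units.coeHom (Matrix n n k))).map
      (Matrix.toLinAlgEquiv' (R := k) (n := n)).toAlgHom.toMonoidHom with hS
  have hSunip : ∀ s ∈ S, IsNilpotent (s - 1) := by
    rintro _ ⟨_, ⟨u, hu, rfl⟩, rfl⟩
    have h := (hU u hu).map (Matrix.toLinAlgEquiv' (R := k) (n := n))
    rw [map_sub, map_one] at h
    exact h
  obtain ⟨F, hF0, hmono, htop, hF⟩ := exists_flag_forall_sub_mem S hSunip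
  refine ⟨F, hF0, hmono, by rwa [Module.finrank_fintype_fun_eq_card] at htop,
    le_flagFiltration_one hF0 hmono fun i u hu v hv => ?_⟩
  exact hF i _ ⟨_, ⟨u, hu, rfl⟩, rfl⟩ v hv

/-! ### Powers in the layers `Φ_a / Φ_{a+1}` -/

/-- **Powers in the layers**: for `g ∈ Φ_a` and `v ∈ F_j`,
`gᴹ v - v - M • (g v - v) ∈ F_{j - 2a}` (binomial expansion: `gᴹ - 1 ≡ M (g - 1)` modulo
`(g - 1)²`, which lowers by `2a`; truncated subtraction). [folklore] -/
theorem pow_glLin_sub_sub_mem {a : ℕ} {g : GL n k} (hg : g ∈ flagFiltration F a) (M : ℕ)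
    {j : ℕ} {v : n → k} (hv : v ∈ F j) :
    glLin (g ^ M) v - v - (M : k) • (glLin g v - v) ∈ F (j - 2 * a) := by
  rw [mem_flagFiltration_iff] at hg
  induction M with
  | zero => simp [glLin_one]
  | succ M ih =>
    -- `d_{M+1} = g d_M + M (g w - w)` with `w = g v - v ∈ F_{j-a}`
    set w : n → k := glLin g v - v with hw
    have hwF : w ∈ F (j - a) := (hg j).2 v hv
    have hgw : glLin g w - w ∈ F (j - 2 * a) := by
      have h := (hg (j - a)).2 w hwF
      rwa [Nat.sub_sub, ← two_mul] at h
    set d : n → k := glLin (g ^ M) v - v - (M : k) • w with hd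
    have hgd : glLin g d ∈ F (j - 2 * a) := (hg (j - 2 * a)).1 d ih
    have e : glLin (g ^ (M + 1)) v - v - ((M + 1 : ℕ) : k) • w =
        glLin g d + (M : k) • (glLin g w - w) := by
      rw [hd, pow_succ', glLin_mul, Module.End.mul_apply, map_sub, map_sub, map_smul,
        Nat.cast_succ, hw]
      module
    rw [e]
    exact Submodule.add_mem _ hgd (Submodule.smul_mem _ _ hgw)

/-- **The layers have no `M`-torsion for `M` invertible in `k`**: for `g ∈ Φ_a`, `a ≥ 1`, `F`
monotone and `(M : k) ≠ 0`, `g ^ M ∈ Φ_{a+1} ↔ g ∈ Φ_{a+1}`. [folklore] -/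
theorem pow_mem_flagFiltration_succ_iff (hF : Monotone F) {a : ℕ} (ha : 1 ≤ a) {g : GL n k}
    (hg : g ∈ flagFiltration F a) {M : ℕ} (hM : (M : k) ≠ 0) :
    g ^ M ∈ flagFiltration F (a + 1) ↔ g ∈ flagFiltration F (a + 1) := by
  refine ⟨fun hgM => ?_, fun h => Subgroup.pow_mem _ h M⟩
  rw [mem_flagFiltration_iff] at hgM ⊢
  intro j
  refine ⟨((mem_flagFiltration_iff.1 hg) j).1, fun v hv => ?_⟩
  -- `M (g v - v) = (gᴹ v - v) - d_M ∈ F_{j-(a+1)}`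
  have h1 := pow_glLin_sub_sub_mem hg M hv
  have h2 : glLin (g ^ M) v - v ∈ F (j - (a + 1)) := (hgM j).2 v hv
  have h3 : (M : k) • (glLin g v - v) ∈ F (j - (a + 1)) := by
    have h12 := Submodule.sub_mem _ h2 (hF (Nat.sub_le_sub_left (by omega) j) h1)
    rwa [sub_sub_cancel] at h12
  have h4 := Submodule.smul_mem _ (M : k)⁻¹ h3
  rwa [smul_smul, inv_mul_cancel₀ hM, one_smul] at h4

/-- **In characteristic `p` the layers are `p`-torsion**: for `g ∈ Φ_a`, `a ≥ 1`, `F` monotone,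
`g ^ p ∈ Φ_{a+1}` (indeed `gᵖ - 1 = (g - 1)ᵖ` lowers by `p a ≥ a + 1`). [folklore] -/
theorem pow_char_mem_flagFiltration_succ (hF : Monotone F) {a : ℕ} (ha : 1 ≤ a) {g : GL n k}
    (hg : g ∈ flagFiltration F a) (p : ℕ) [CharP k p] :
    g ^ p ∈ flagFiltration F (a + 1) := by
  rw [mem_flagFiltration_iff]
  intro j
  refine ⟨((mem_flagFiltration_iff.1 (Subgroup.pow_mem _ hg p)) j).1, fun v hv => ?_⟩
  have h1 := pow_glLin_sub_sub_mem hg p hv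
  rw [CharP.cast_eq_zero, zero_smul, sub_zero] at h1
  exact hF (Nat.sub_le_sub_left (by omega) j) h1

end Literature.NumberTheory.Automorphic
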